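import Summits.QuantumFields.YangMills.Theorems.BalabanUVNodesN15SiteCurvedByPartsFamily
import Summits.QuantumFields.YangMills.Theorems.BalabanUVNodesN15CurvedCoefOneDictionary
import HarnessLib

/-!
# Route «BalabanUVNodes», cluster K4 «SpineRates» — node N15 = NE2: THE SITE LAYER WITH THE BACKGROUND LIVE IN THE TwoGrid ENTRY CURRENCY, XLVI — THE CURVED READINGS' LETTER
# BUNDLE FROM THE (3.35) WINDOW (dag-n15-w2's p648808 `twoSidedLetters_curvCoef_one_of_gauge` BY NAME, with dag-n15-w3's torus block-mean fits), AND THE HYPOTHESIS-FREE BUNDLE: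
# the curved King family with the background live is `Live ∧ N15At` — ALL FOUR (3.42) ENTRIES, entry 2 by parts — NOTHING displayed but the MODEL

Cell `pub-ymgap`, WIDTH SEAT `pub-ymgap-dag-n15-w1` (generation 5; director-ym №197 ∕ HUMAN RULING D-0149, №219 (1); chair R455 (A) ∕ R461; dag-lead KEY MAP v2 INBOX l.35754;
the located sequel (o1) of dag-n15-e g15 INBOX l.39322 ∕ l.39620; dag-n15-d g18 l.40235; dag-n15-w2 g6 p648808 (their answer to this seat's ask (ii)); CLAIM-11).  `bears_on: R4∕N15 · K3⁸
SpineGivenEndpointR13SepCoPHV (stmt-QuantumFields-27366; K3⁷ 20544 aside = lineage)`.  Filed `--kind proof --supports stmt-QuantumFields-27366 --as helper` — COUNT-NEUTRAL.  THEOREMS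
ONLY (0 `def`, 0 `sorry`).  Imports BY NAME part XLIV `…N15SiteCurvedByPartsFamily` (`curvCfgF`∕`curvCfgC`∕`curvKopBP`∕`curvCarriersBP`, ★★★ `ne2PlusOperator_curvKopBP_of_twoSidedLetters`,
`live_and_n15At_curvCarriersBP_of_twoSidedLetters`; through it parts XXXIII∕XXXVII `curvBgF`∕`curvPairing`∕`curvCarriers`, n15-w3 `blockMeanField`∕`blockMeanTV`∕`fit_blockMeanTV`∕
`fit_bdiffTV_blockMeanTV`∕`norm_fdiffTV_blockMeanTV_le`∕`norm_blockMeanTV_le`∕`blockOf_sub_unitVec_compat`, n15-w2 `coordMat_adCLM_transpose_eq_neg_of_conjTranspose`) and dag-n15-w2 g6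
`…N15CurvedCoefOneDictionary` (p648808: ★ `twoSidedLetters_curvCoef_one_of_gauge`; through it dag-n15-c FILE 29b's fifteen letters); nothing in the tree is modified.

WHY ∕ WHAT IT SAYS.  Part XLIV left ONE displayed input: the window delivers FILE 24's fifteen coefficient letters `TwoSidedLetters` of the curved readings.  dag-n15-w2 g6 typed the
dictionary (p648808): the curved coefficients of an exact exponential transporter field at the flat base point ARE dag-n15-c's exact gauge coefficients, so the fifteen letters hold given
the GAUGE-FIELD letters of the fine field `A′` and of its coarse partner `A` (skewness in coordinates, sup `≤ r`, one-step differences `≤ rη′` ∕ `≤ rη`, fit ∕ translated fit ∕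
derivative fit `≤ rθ`, `η′ ≤ η ≤ min(1, θ)`, `2(1+|J|)r ≤ 1`).  §1 ★★ `twoSidedLetters_curvCfg_of_reg335`: those gauge-field letters for `A′ = U′ ∈ (curvBgF).Reg335 c₃₅ α₀` (skew-
Hermitian, sup `≤ c₃₅M_szα₀`, one-step gradient `≤ η′·c₃₅M_szα₀`, second differences `≤ η′·c₃₅M_szα₀`) and `A =` its King block mean (part XXXIII's pairing): skewness through `he`
(n15-w2 `coordMat_adCLM_transpose_eq_neg_of_conjTranspose`) and the real-weight mean; sup ∕ gradient of the mean, fit, translated fit (n15-w3 `blockOf_sub_unitVec_compat`) and the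
derivative fit from dag-n15-w3's torus block-mean letters; `θ_i = (L^K)^{−γ∕2} ≥ η = L^{−K}`; scale `r = (d+3)·c₃₅M_szα₀`; the window `c₃₅M_szα₀ ≤ r₀ = (2(d+3)²)⁻¹` gives `2(1+|J|)r ≤ 1`.
§2 ★★★ **`ne2PlusOperator_curvKopBP`** and ★★★ **`live_and_n15At_curvCarriersBP`**: part XLIV's `…_of_twoSidedLetters` with §1 — the curved King family (King's massless coloured
`A₀⁻¹ ⊗ 1` dressed by the exact adjoint transporters `Ad(e^{η′A′})` of every small, slowly varying skew-Hermitian potential, flat base point, one blocking step, King block-mean coarse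
potential; dag-n15-c FILE 24's two-sided by-parts family at these readings) satisfies `NE2PlusOperator` with ALL FOUR (3.42) entries and `Live ∧ N15At` — hypotheses: `he` (the
coordinates are orthonormal for the trace form), odd `L ≥ 3`, `a > 0`, `0 < γ < 1`, `c₃₅ > 0`, `m² > 0` for the unit layer; NOTHING displayed.

HONEST FRAMING ∕ LIMITS.  Count-neutral KNIT; no new estimate.  MODEL-LEVEL: King's `A = 0` objects ([King1986]), exact adjoint transporters of a potential (dag-n15-w2), flat base
point, one blocking step; the operator layer is dag-n15-c's by-parts family (entry 2 = `X∇*` only in the regime, part XLII; entry 3 = n15-b's derived entry); nothing of [B5]∕[B6]∕[B9]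
asserted ((3.35)–(3.36) p. 396, Thm 3.1 (3.42) p. 397, Thm 3.2 (3.48) p. 398, (3.52) p. 400, (3.63)–(3.65) pp. 402–403, Thm 3.15 (3.187) p. 432 = SHAPES ∕ MECHANISM).  NOT Bałaban's
`G(U)` ∕ `C^{(k)}(U)` (multiscale carrier, `(L^jη)`-prefactors, axial gauge, Landau-gauge `R`); NE2⁺ NOT PRINTED ∕ NOT proved for d = 4; **N15 is NOT discharged**; K3⁸ OPEN, not
claimed, skeleton v6 untouched (its N15 pin is `fullGSizedObjects`; nothing here re-pins; `KeyedLive` untouched); counts of record UNMOVED (typed 28∕28 · discharged 5∕27, A 5∕28); one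
finite four-torus programme at fixed `ε` — NOT ℝ⁴, NOT infinite volume, NOT OS, NOT a mass gap, NOT Clay; R4 closes the conditional finite-𝕋⁴ rung `BalabanLadder.UV` only.  Restate-immune.
-/

set_option autoImplicit false

noncomputable section
open scoped BigOperators Matrix Matrix.Norms.Frobenius

namespace Summit.QuantumFields.YangMills.BalabanUVNodes.N15.SiteLayerBg

open Finset
open Literature.MathematicalPhysics.QuantumFieldTheory.Balaban1983to89
open Literature.MathematicalPhysics.QuantumFieldTheory.Balaban1983to89.T4EtaRate (NE2PlusOperator)
open Literature.MathematicalPhysics.QuantumFieldTheory.Balaban1983to89.B5Prop11Plancherel (Tor fine unitVec)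
open Literature.MathematicalPhysics.QuantumFieldTheory.King1986.Torus (site blockOf)
open Literature.MathematicalPhysics.QuantumFieldTheory.Balaban1983to89.Beta.AveragingCorrectionJets (adCLM)
open Literature.Barriers.QuantumFields (traceForm)
open Summit.QuantumFields.YangMills.BalabanUVNodes.N15.VectorPiece (unitTorusGeoS)
open Summit.QuantumFields.YangMills.BalabanUVNodes.N15.MatrixSpecies (coordMat basisConst basisConst_nonneg)
open Summit.QuantumFields.YangMills.BalabanUVNodes.N15.BackgroundLayer (TwoSidedLetters)
open Summit.QuantumFields.YangMills.BalabanUVNodes.N15.CurvedSpecies (torStep torStep_symm_apply blockMeanField blockMeanTV fit_blockMeanTV fit_bdiffTV_blockMeanTV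
  norm_fdiffTV_blockMeanTV_le norm_blockMeanTV_le blockOf_sub_unitVec_compat twoSidedLetters_curvCoef_one_of_gauge coordMat_adCLM_transpose_eq_neg_of_conjTranspose)
open Summit.QuantumFields.YangMills.BalabanUVNodes.N15.PairedFamilyGuard (Live)
open Summit.QuantumFields.YangMills.BalabanUVNodes.N15KingModelRung (KingVolIndex)
open Summit.QuantumFields.YangMills.BalabanUVNodes.N15KingModelRung.Curved
open YMDAG.UVSplit (NE2Carriers N15At)

variable {d : ℕ} (L : ℕ) [NeZero L]
variable {n : Type} [Fintype n] [DecidableEq n] (κ : Type) [Fintype κ] [DecidableEq κ] (e : Matrix n n ℂ ≃L[ℝ] (κ → ℝ)) (a : ℝ)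

/-! ## §1 ★★ The curved readings' fifteen letters from the (3.35) window -/

section Letters

omit [NeZero L] [DecidableEq n] [Fintype κ] [DecidableEq κ] in
/-- The King block mean of a skew-Hermitian matrix field is skew-Hermitian (real weights). [folklore] -/
theorem blockMeanTV_conjTranspose_of_skew {M : Fin (d + 1) → ℕ} [∀ μ, NeZero (M μ)] {U : Tor (fine L M) → Matrix n n ℂ} (h : ∀ y', (U y')ᴴ = -U y') (b : Tor M) :
    (blockMeanTV L M U b)ᴴ = -blockMeanTV L M U b := by
  simp only [blockMeanTV, Matrix.conjTranspose_smul, Matrix.conjTranspose_sum, h, Finset.sum_neg_distrib, smul_neg, star_trivial]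

set_option maxHeartbeats 800000 in -- one theorem, fifteen letters: the `set` abbreviations + dag-n15-w2's 17-hypothesis dictionary elaborate in ≈ 2× the default budget (kernel-checked; XXI ∕ XXXIX precedent)
/-- ★★ **THE FIFTEEN LETTERS OF THE CURVED READINGS FROM THE WINDOW** (part XLIV's `hLt`): for `L ≥ 2`, `0 < γ < 1`, `c₃₅ ≥ 0` and coordinates `e` orthonormal for the trace form, with
`κ′ = 14e(d+3)³·basisConst e + 1`, `r₀ = (2(d+3)²)⁻¹`: every `U′ ∈ (curvBgF L n i).Reg335 c₃₅ α₀` (`α₀ > 0`) in the window `c₃₅M_szα₀ ≤ r₀` has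
`TwoSidedLetters (Fin (d+1)) κ (blockOf L) τ τ′ (L^K) (L^{K+1}) (κ′·c₃₅M_szα₀) ((L^K)^{−γ∕2}) (curvCfgF U′) (curvCfgC U′)` — dag-n15-w2 `twoSidedLetters_curvCoef_one_of_gauge` fed with the
window's letters of `U′` and dag-n15-w3's block-mean letters of `QU′` at scale `(d+3)·c₃₅M_szα₀`.
[cite: Balaban1985BackgroundPropagators, (3.35)–(3.36) p.396 (the window: shape), (3.50)–(3.52) p.400 (the coefficients: shape); King1986, p.664 (block means)] -/
theorem twoSidedLetters_curvCfg_of_reg335 (he : ∀ X Y : Matrix n n ℂ, traceForm X Y = e X ⬝ᵥ e Y) (hL : 2 ≤ L) {γ : ℝ} (hγ0 : 0 < γ) (hγ1 : γ < 1) {c35 : ℝ} (hc35 : 0 ≤ c35)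
    (i : KingVolIndex d × Fin (d + 1)) (U : (curvBgF L n i.1).Cfg) (α₀ : ℝ) (hreg : (curvBgF L n i.1).Reg335 c35 α₀ U) (hα₀ : 0 < α₀)
    (hM : 1 ≤ (unitTorusGeoS L i.1.K (curvCube L i.1) i.1.Msz).M)
    (hr : c35 * (unitTorusGeoS L i.1.K (curvCube L i.1) i.1.Msz).M * α₀ ≤ (2 * ((d : ℝ) + 3) * ((d : ℝ) + 3))⁻¹) :
    TwoSidedLetters (Fin (d + 1)) κ (blockOf L (fine (L ^ i.1.K) (curvCube L i.1))) (torStep (fine (L ^ i.1.K) (curvCube L i.1)))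
      (torStep (fine L (fine (L ^ i.1.K) (curvCube L i.1)))) ((L : ℝ) ^ i.1.K) ((L : ℝ) ^ (i.1.K + 1))
      ((14 * Real.exp 1 * ((d : ℝ) + 3) ^ 3 * basisConst e + 1) * (c35 * (unitTorusGeoS L i.1.K (curvCube L i.1) i.1.Msz).M * α₀)) (((L : ℝ) ^ i.1.K) ^ (-(γ / 2)))
      (curvCfgF L κ e i.1 U) (curvCfgC L κ e i.1 U) := by
  obtain ⟨hskew, hA, hgradA, hsecA⟩ := hreg
  have hLr : (1 : ℝ) ≤ (L : ℝ) := by exact_mod_cast (show 1 ≤ L by omega)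
  have hLpos : (0 : ℝ) < (L : ℝ) := by positivity
  have hMsz : (unitTorusGeoS L i.1.K (curvCube L i.1) i.1.Msz).M = i.1.Msz := rfl
  rw [hMsz] at hM hr ⊢
  -- abbreviations
  set K := i.1.K with hKdef
  set Mc : Fin (d + 1) → ℕ := fine (L ^ K) (curvCube L i.1) with hMc
  set η' : ℝ := ((L : ℝ) ^ (K + 1))⁻¹ with hη'def
  set c : ℝ := c35 * (i.1.Msz * α₀) with hcdef
  set θ : ℝ := ((L : ℝ) ^ K) ^ (-(γ / 2)) with hθdef
  have hc0 : 0 ≤ c := mul_nonneg hc35 (mul_nonneg (zero_le_one.trans hM) hα₀.le)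
  have hcc : c35 * i.1.Msz * α₀ = c := by rw [hcdef]; ring
  have hη' : 0 < η' := by positivity
  -- the coarse spacing `η = L·η′ = (L^K)⁻¹`
  have hLη : (L : ℝ) * η' = (L : ℝ) * ((L : ℝ) ^ (K + 1))⁻¹ := rfl
  have hηK : (L : ℝ) * ((L : ℝ) ^ (K + 1))⁻¹ = ((L : ℝ) ^ K)⁻¹ := by
    rw [pow_succ, mul_inv, mul_comm ((L : ℝ) ^ K)⁻¹, ← mul_assoc, mul_inv_cancel₀ hLpos.ne', one_mul]
  have hLK1 : (1 : ℝ) ≤ (L : ℝ) ^ K := one_le_pow₀ hLr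
  have hη'η : η' ≤ (L : ℝ) * ((L : ℝ) ^ (K + 1))⁻¹ := le_mul_of_one_le_left hη'.le hLr
  have hη0 : 0 < (L : ℝ) * ((L : ℝ) ^ (K + 1))⁻¹ := lt_of_lt_of_le hη' hη'η
  have hη1 : (L : ℝ) * ((L : ℝ) ^ (K + 1))⁻¹ ≤ 1 := by rw [hηK]; exact inv_le_one_of_one_le₀ hLK1
  have hηθ : (L : ℝ) * ((L : ℝ) ^ (K + 1))⁻¹ ≤ θ := by
    rw [hηK, hθdef, ← Real.rpow_neg_one]
    exact Real.rpow_le_rpow_of_exponent_le hLK1 (by linarith)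
  have hθ0 : 0 ≤ θ := Real.rpow_nonneg (pow_nonneg hLpos.le _) _
  have hLm1 : ((L : ℝ) - 1) * η' ≤ (L : ℝ) * ((L : ℝ) ^ (K + 1))⁻¹ := by nlinarith [hη'.le]
  -- the scale `r = (d+3)c` and the smallness `2(1+|J|)r ≤ 1`
  set r : ℝ := ((d : ℝ) + 3) * c with hrdef
  have hd0 : (0 : ℝ) ≤ d := Nat.cast_nonneg d
  have hr0 : 0 ≤ r := mul_nonneg (by positivity) hc0
  have hcr : c ≤ r := le_mul_of_one_le_left hc0 (by linarith)
  have hX : 0 < 2 * ((d : ℝ) + 3) * ((d : ℝ) + 3) := by positivity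
  have hc1 : c * (2 * ((d : ℝ) + 3) * ((d : ℝ) + 3)) ≤ 1 := by
    rw [← hcc]
    calc c35 * i.1.Msz * α₀ * (2 * ((d : ℝ) + 3) * ((d : ℝ) + 3)) ≤ (2 * ((d : ℝ) + 3) * ((d : ℝ) + 3))⁻¹ * (2 * ((d : ℝ) + 3) * ((d : ℝ) + 3)) :=
          mul_le_mul_of_nonneg_right hr hX.le
      _ = 1 := inv_mul_cancel₀ hX.ne'
  have hr2 : 2 * ((1 + Fintype.card (Fin (d + 1))) * r) ≤ 1 := by
    rw [Fintype.card_fin, hrdef]; push_cast; nlinarith [hc1, hc0, hd0]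
  -- skewness in coordinates (through `he`): the field and its King block mean
  have hZ' : ∀ μ x', (coordMat e (adCLM ℝ (U μ x')))ᵀ = -coordMat e (adCLM ℝ (U μ x')) := fun μ x' =>
    coordMat_adCLM_transpose_eq_neg_of_conjTranspose e he (hskew μ x')
  have hZ : ∀ μ x, (coordMat e (adCLM ℝ ((curvPairing L κ i.1).avg U μ x)))ᵀ = -coordMat e (adCLM ℝ ((curvPairing L κ i.1).avg U μ x)) := fun μ x =>
    coordMat_adCLM_transpose_eq_neg_of_conjTranspose e he (blockMeanTV_conjTranspose_of_skew L (hskew μ) x)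
  -- sup letters
  have hs' : ∀ μ x', ‖U μ x'‖ ≤ r := fun μ x' => (hA μ x').trans hcr
  have hs : ∀ μ x, ‖(curvPairing L κ i.1).avg U μ x‖ ≤ r := fun μ x => norm_blockMeanTV_le L Mc hr0 fun j => hs' μ _
  -- one-step differences
  have hd' : ∀ μ x', ‖U μ x' - U μ ((torStep (fine L Mc) μ).symm x')‖ ≤ r * η' := fun μ x' => by
    rw [torStep_symm_apply]
    calc ‖U μ x' - U μ (x' - KingTorusLine.unitVec (fine L Mc) μ)‖ ≤ η' * c := hgradA μ μ x'
      _ ≤ r * η' := by nlinarith [hcr, hη'.le]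
  have hq : ∀ μ (w : Tor (fine L Mc)) (ν : Fin (d + 1)), ‖η'⁻¹ • (U μ (w + unitVec (fine L Mc) ν) - U μ w)‖ ≤ c := fun μ w ν => by
    have h := hgradA μ ν (w + unitVec (fine L Mc) ν)
    rw [add_sub_cancel_right] at h
    rw [norm_smul, norm_inv, Real.norm_of_nonneg hη'.le]
    calc η'⁻¹ * ‖U μ (w + unitVec (fine L Mc) ν) - U μ w‖ ≤ η'⁻¹ * (η' * c) := mul_le_mul_of_nonneg_left h (inv_nonneg.mpr hη'.le)
      _ = c := by rw [← mul_assoc, inv_mul_cancel₀ hη'.ne', one_mul]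
  have hdc : ∀ μ (b : Tor Mc), ‖blockMeanTV L Mc (U μ) (b + unitVec Mc μ) - blockMeanTV L Mc (U μ) b‖ ≤ (L : ℝ) * ((L : ℝ) ^ (K + 1))⁻¹ * c := fun μ b => by
    have h := norm_fdiffTV_blockMeanTV_le L Mc μ hLη hc0 (a' := U μ) (b := b) fun j k _ => hq μ _ μ
    rw [norm_smul, norm_inv, Real.norm_of_nonneg hη0.le, inv_mul_le_iff₀ hη0] at h
    exact h
  have hd : ∀ μ x, ‖(curvPairing L κ i.1).avg U μ x - (curvPairing L κ i.1).avg U μ ((torStep Mc μ).symm x)‖ ≤ r * ((L : ℝ) * ((L : ℝ) ^ (K + 1))⁻¹) := fun μ x => by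
    rw [torStep_symm_apply]
    have h := hdc μ (x - unitVec Mc μ)
    rw [sub_add_cancel] at h
    calc ‖(curvPairing L κ i.1).avg U μ x - (curvPairing L κ i.1).avg U μ (x - KingTorusLine.unitVec Mc μ)‖ ≤ (L : ℝ) * ((L : ℝ) ^ (K + 1))⁻¹ * c := h
      _ ≤ r * ((L : ℝ) * ((L : ℝ) ^ (K + 1))⁻¹) := by nlinarith [hcr, hη0.le]
  -- the fit of the field to its block mean
  have hfit : ∀ μ (y' : Tor (fine L Mc)), ‖U μ y' - blockMeanTV L Mc (U μ) (blockOf L Mc y')‖ ≤ ((d : ℝ) + 1) * (θ * c) := fun μ y' => by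
    have h := fit_blockMeanTV L Mc (a' := U μ) (θ₁ := fun _ => η' * c) (fun _ => by positivity)
      (fun y' ν _ => by have h1 := hgradA μ ν (y' + unitVec (fine L Mc) ν); rwa [add_sub_cancel_right] at h1) y'
    refine h.trans ?_
    push_cast
    have h2 : ((L : ℝ) - 1) * (η' * c) ≤ θ * c := by nlinarith [hLm1, hηθ, hc0]
    nlinarith [h2, hd0]
  have hf : ∀ μ x', ‖U μ x' - (curvPairing L κ i.1).avg U μ (blockOf L Mc x')‖ ≤ r * θ := fun μ x' =>
    (hfit μ x').trans (by rw [hrdef]; nlinarith [mul_nonneg hθ0 hc0])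
  -- the translated fit (one fine step back stays in the block or crosses to the previous one)
  have hfT : ∀ μ x', ‖U μ ((torStep (fine L Mc) μ).symm x') - (curvPairing L κ i.1).avg U μ ((torStep Mc μ).symm (blockOf L Mc x'))‖ ≤ r * θ := fun μ x' => by
    rw [torStep_symm_apply, torStep_symm_apply]
    rcases blockOf_sub_unitVec_compat L Mc x' μ with h1 | h1
    · have hins : U μ (x' - KingTorusLine.unitVec (fine L Mc) μ) - (curvPairing L κ i.1).avg U μ (blockOf L Mc x' - KingTorusLine.unitVec Mc μ) =
          (U μ (x' - KingTorusLine.unitVec (fine L Mc) μ) - blockMeanTV L Mc (U μ) (blockOf L Mc (x' - KingTorusLine.unitVec (fine L Mc) μ))) +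
          (blockMeanTV L Mc (U μ) (blockOf L Mc x') - blockMeanTV L Mc (U μ) (blockOf L Mc x' - KingTorusLine.unitVec Mc μ)) := by
        rw [h1]; show _ = (_ - blockMeanTV L Mc (U μ) (blockOf L Mc x')) + _; abel
      rw [hins]
      refine (norm_add_le _ _).trans ?_
      have h2 := hdc μ (blockOf L Mc x' - unitVec Mc μ)
      rw [sub_add_cancel] at h2
      calc ‖U μ (x' - KingTorusLine.unitVec (fine L Mc) μ) - blockMeanTV L Mc (U μ) (blockOf L Mc (x' - KingTorusLine.unitVec (fine L Mc) μ))‖ +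
            ‖blockMeanTV L Mc (U μ) (blockOf L Mc x') - blockMeanTV L Mc (U μ) (blockOf L Mc x' - KingTorusLine.unitVec Mc μ)‖
          ≤ ((d : ℝ) + 1) * (θ * c) + (L : ℝ) * ((L : ℝ) ^ (K + 1))⁻¹ * c := add_le_add (hfit μ _) h2
        _ ≤ r * θ := by rw [hrdef]; nlinarith [hηθ, hc0, mul_nonneg hθ0 hc0]
    · rw [← h1]
      exact (hfit μ _).trans (by rw [hrdef]; nlinarith [mul_nonneg hθ0 hc0])
  -- the derivative fit (second differences)
  have hfD : ∀ μ x', ‖η'⁻¹ • (U μ x' - U μ ((torStep (fine L Mc) μ).symm x')) -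
      ((L : ℝ) * ((L : ℝ) ^ (K + 1))⁻¹)⁻¹ • ((curvPairing L κ i.1).avg U μ (blockOf L Mc x') - (curvPairing L κ i.1).avg U μ ((torStep Mc μ).symm (blockOf L Mc x')))‖ ≤ r * θ :=
    fun μ x' => by
    rw [torStep_symm_apply, torStep_symm_apply]
    have h := fit_bdiffTV_blockMeanTV L Mc μ hLη (a' := U μ) (θ₂ := fun _ => η' * c) (fun _ => by positivity)
      (fun b z' _ ν => by simpa only [kingTorusLine_unitVec_eq] using hsecA μ ν z') x'
    refine h.trans ?_
    push_cast
    have h2 : ((L : ℝ) - 1) * (η' * c) ≤ θ * c := by nlinarith [hLm1, hηθ, hc0]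
    rw [hrdef]; nlinarith [h2, hd0, mul_nonneg hθ0 hc0]
  -- dag-n15-w2's dictionary theorem, then the scale bookkeeping
  have key := twoSidedLetters_curvCoef_one_of_gauge e (ι := κ) (J := Fin (d + 1)) (π := blockOf L Mc) (s := torStep Mc) (s' := torStep (fine L Mc)) (θ := θ)
    (A' := U) (A := (curvPairing L κ i.1).avg U) hη' hη'η hη1 hηθ hr0 hr2 hZ' hZ hs' hs hd' hd hf hfT hfD
  have hn : ((L : ℝ) * ((L : ℝ) ^ (K + 1))⁻¹)⁻¹ = (L : ℝ) ^ K := by rw [hηK, inv_inv]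
  rw [hn, inv_inv] at key
  have hscale : 14 * Real.exp 1 * (1 + Fintype.card (Fin (d + 1))) * basisConst e * ((1 + Fintype.card (Fin (d + 1))) * r) ≤
      (14 * Real.exp 1 * ((d : ℝ) + 3) ^ 3 * basisConst e + 1) * (c35 * i.1.Msz * α₀) := by
    rw [Fintype.card_fin, hrdef, hcc]
    push_cast
    have hb := basisConst_nonneg e
    have he1 : 0 ≤ Real.exp 1 := (Real.exp_pos 1).le
    have h3 : (1 + ((d : ℝ) + 1)) * ((1 + ((d : ℝ) + 1)) * ((d : ℝ) + 3)) ≤ ((d : ℝ) + 3) ^ 3 := by nlinarith [hd0]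
    have h4 : 0 ≤ 14 * Real.exp 1 * basisConst e * c := by positivity
    nlinarith [mul_le_mul_of_nonneg_left h3 h4, hc0]
  unfold curvCfgF curvCfgC
  exact key.mono hscale hθ0

end Letters

/-! ## §2 ★★★ The hypothesis-free bundle -/

section Bundle

/-- ★★★ **NE2⁺, OPERATOR LAYER, ALL FOUR (3.42) ENTRIES, FOR THE CURVED KING FAMILY WITH THE BACKGROUND LIVE — NOTHING DISPLAYED**: part XLIV ★★★
`ne2PlusOperator_curvKopBP_of_twoSidedLetters` with §1 (`κ′ = 14e(d+3)³basisConst e + 1`, `r₀ = (2(d+3)²)⁻¹`). [cite: Balaban1985BackgroundPropagators, Thm 3.1 (3.42) p.397 (quantifier template, the four entries: shape); (3.35)–(3.36) p.396, (3.52) p.400, (3.63)–(3.65) pp.402–403 (mechanism); King1986, (2.13)–(2.17) p.653, p.664, (4.1)–(4.5) p.670] -/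
theorem ne2PlusOperator_curvKopBP (he : ∀ X Y : Matrix n n ℂ, traceForm X Y = e X ⬝ᵥ e Y) (hLodd : Odd L) (hL : 2 ≤ L) (ha : 0 < a) {γ : ℝ} (hγ0 : 0 < γ) (hγ1 : γ < 1)
    {c35 : ℝ} (hc35 : 0 < c35) :
    NE2PlusOperator c35 (fun i : KingVolIndex d × Fin (d + 1) => curvPI L κ n i.1) (curvKopBP L κ e a) :=
  ne2PlusOperator_curvKopBP_of_twoSidedLetters (d := d) L κ e a hLodd hL ha hγ0 hγ1 c35 (14 * Real.exp 1 * ((d : ℝ) + 3) ^ 3 * basisConst e + 1)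
    (2 * ((d : ℝ) + 3) * ((d : ℝ) + 3))⁻¹ hc35 (by have := basisConst_nonneg e; positivity) (by positivity)
    fun i U α₀ hreg hα₀ hM hr => twoSidedLetters_curvCfg_of_reg335 L κ e he hL hγ0 hγ1 hc35.le i U α₀ hreg hα₀ hM hr

/-- ★★★ **THE CURVED KING FAMILY WITH THE BACKGROUND LIVE IS `Live ∧ N15At` — NOTHING DISPLAYED BUT THE MODEL**: operator layer (all four entries, entry 2 by parts) = the above; site
layer part XXXIII; unit layer part XXXVII (massive, `m² > 0`); liveness part XXXVII.  Hypotheses: the coordinates `e` are orthonormal for the trace form (`he`), odd `L ≥ 3`, `a > 0`,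
`0 < γ < 1`, `c₃₅ > 0`, `m² > 0`, block size `p`, colours `c, c′`.  MODEL-LEVEL; N15 is NOT discharged by this theorem (the K3⁸ skeleton pins `fullGSizedObjects`).
[cite: Balaban1985BackgroundPropagators, Thm 3.1 p.397, Thm 3.2 (3.48) p.398, Thm 3.15 (3.187) p.432 (shapes); King1986, Lemma 4.5 (4.38) p.674] -/
theorem live_and_n15At_curvCarriersBP (he : ∀ X Y : Matrix n n ℂ, traceForm X Y = e X ⬝ᵥ e Y) (hLodd : Odd L) (hL : 2 ≤ L) (ha : 0 < a) {γ : ℝ} (hγ0 : 0 < γ)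
    (hγ1 : γ < 1) {c35 : ℝ} (hc35 : 0 < c35) {m2 : ℝ} (hm : 0 < m2) (p : ℝ) (c c' : KingVolIndex d → κ) :
    Live (curvCarriersBP L κ e a c35 p m2 c c') ∧ N15At (curvCarriersBP L κ e a c35 p m2 c c') :=
  live_and_n15At_curvCarriersBP_of_twoSidedLetters (d := d) L κ e a he hLodd hL ha hγ0 hγ1 hc35 hm p c c' (14 * Real.exp 1 * ((d : ℝ) + 3) ^ 3 * basisConst e + 1)
    (2 * ((d : ℝ) + 3) * ((d : ℝ) + 3))⁻¹ (by have := basisConst_nonneg e; positivity) (by positivity)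
    fun i U α₀ hreg hα₀ hM hr => twoSidedLetters_curvCfg_of_reg335 L κ e he hL hγ0 hγ1 hc35.le i U α₀ hreg hα₀ hM hr

end Bundle

end Summit.QuantumFields.YangMills.BalabanUVNodes.N15.SiteLayerBg

end
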